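import Summits.Ventures.PercRepro.Night2ShadowForm

/-!
# PercRepro — the direct-hull bound for the shadow of a family (night-2, gen 5)

For a family `𝒜 ⊆ Uq M (q + 2) q` let the HULL `hull M 𝒜` be the set of all `T` with `B ⊆ T ⊆ cl B` for some `B ∈ 𝒜`
(rank-`q` sets with the closure of a member).  For a ground element `x` the middle level contains
* the sets `T ∪ {x}` for `T ∈ hull` with `x ∉ cl T` (pairwise distinct; they contain `x`), and
* the sets `T ∪ {z}` for `T ∈ hull` with `x ∉ T`, `z ∉ cl T`, `z ≠ x` (they avoid `x`; at most `q + 1` preimages each —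
  a preimage `(T, z)` is determined by the coloop `z` of `T ∪ {z}`, and a rank-`(q + 1)` set has `≤ q + 1` coloops).
Hence the DIRECT-HULL BOUND `directHull M q 𝒜 x ≤ #shadow M (q + 2) q 𝒜` (`directHull_le_card_shadow`), with
`directHull M q 𝒜 x = #{T ∈ hull : x ∉ cl T} + (Σ_{T ∈ hull, x ∉ T} #((E ∖ cl T) ∖ {x})) / (q + 1)`.
At an `x` outside every closure this is the e-lemma of `Night2ShadowForm.lean`.  THE SELECTION CONJECTURE
`DirectHullSelection` (census `mining/night-2/g5/hull_test.py`: every loopless matroid on ≤ 8 elements, every sub-family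
whose closures cover `E` with empty intersection — 129,078 tests, 0 failures, worst ratio exactly 1; the element lying
in the fewest closures always works) says that for such «mixed» families some `x` makes the direct-hull bound reach
`((q + 2)/(q + 1)) · #𝒜`.  With the e-lemma (an element outside every closure) and `Night2ShadowContract.lean` (an
element inside every closure, from the induction hypotheses) it would close the inductive step of the diagonal shadow
form C-033 at every `q` (`proofs/NIGHT-2-shadow.md` §8–§9).
-/

namespace PercRepro.Shadow

open Finset PerFlat ThmH

variable {α : Type*} [DecidableEq α] {M : Matroid α} [M.Finite]

/-- The hull of a family: all `T` with `B ⊆ T ⊆ cl B` for some member `B`. -/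
noncomputable def hull (M : Matroid α) [M.Finite] (𝒜 : Finset (Finset α)) : Finset (Finset α) :=
  𝒜.biUnion (fun B => ((clF M B) \ B).powerset.image (fun D => B ∪ D))

/-- Membership in the hull (for a family of bottom sets). -/
theorem mem_hull {p q : ℕ} {𝒜 : Finset (Finset α)} (h𝒜 : 𝒜 ⊆ Uq M p q) {T : Finset α} :
    T ∈ hull M 𝒜 ↔ ∃ B ∈ 𝒜, B ⊆ T ∧ T ⊆ clF M B := by
  unfold hull
  simp only [Finset.mem_biUnion, Finset.mem_image, Finset.mem_powerset]
  constructor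
  · rintro ⟨B, hB, D, hD, rfl⟩
    refine ⟨B, hB, Finset.subset_union_left, ?_⟩
    intro x hx
    rw [Finset.mem_union] at hx
    rcases hx with hx | hx
    · exact subset_clF (h𝒜 hB) hx
    · exact (Finset.mem_sdiff.1 (hD hx)).1
  · rintro ⟨B, hB, hBT, hTB⟩
    refine ⟨B, hB, T \ B, ?_, ?_⟩
    · intro x hx
      rw [Finset.mem_sdiff] at hx ⊢
      exact ⟨hTB hx.1, hx.2⟩
    · rw [Finset.union_sdiff_of_subset hBT]

omit [DecidableEq α] in
/-- `B ⊆ T ⊆ cl B` forces `cl T = cl B`. -/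
theorem clF_eq_of_between {B T : Finset α} (hBT : B ⊆ T) (hTB : T ⊆ clF M B) :
    clF M T = clF M B := by
  apply Finset.coe_injective
  rw [coe_clF, coe_clF]
  apply le_antisymm
  · have h1 : (T : Set α) ⊆ M.closure (B : Set α) := by rw [← coe_clF]; exact_mod_cast hTB
    calc M.closure (T : Set α) ⊆ M.closure (M.closure (B : Set α)) := M.closure_subset_closure h1
      _ = M.closure (B : Set α) := M.closure_closure _
  · exact M.closure_subset_closure (by exact_mod_cast hBT)

/-- A hull set has the rank and the closure of a member, and lies in the ground set. -/
theorem hull_facts {p q : ℕ} {𝒜 : Finset (Finset α)} (h𝒜 : 𝒜 ⊆ Uq M p q) {T : Finset α} (hT : T ∈ hull M 𝒜) :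
    T ⊆ gr M ∧ M.eRk (T : Set α) = (q : ℕ∞) ∧ ∃ B ∈ 𝒜, B ⊆ T ∧ clF M T = clF M B := by
  rw [mem_hull h𝒜] at hT
  obtain ⟨B, hB, hBT, hTB⟩ := hT
  have hBU := mem_Uq.1 (h𝒜 hB)
  have hcl : clF M T = clF M B := clF_eq_of_between hBT hTB
  have hclg : clF M B ⊆ gr M := by
    rw [← Finset.coe_subset, coe_clF, coe_gr]
    exact M.closure_subset_ground _
  refine ⟨hTB.trans hclg, ?_, B, hB, hBT, hcl⟩
  have h1 : M.eRk ((clF M B : Finset α) : Set α) = (q : ℕ∞) := by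
    rw [coe_clF, M.eRk_closure_eq, hBU.2.1]
  apply le_antisymm
  · calc M.eRk (T : Set α) ≤ M.eRk ((clF M B : Finset α) : Set α) := M.eRk_mono (by exact_mod_cast hTB)
      _ = (q : ℕ∞) := h1
  · calc (q : ℕ∞) = M.eRk (B : Set α) := hBU.2.1.symm
      _ ≤ M.eRk (T : Set α) := M.eRk_mono (by exact_mod_cast hBT)

/-- `T ∪ {z}` is a middle-level set above the member below `T` when `z ∉ cl T`. -/
theorem insert_mem_shadow_of_mem_hull {q : ℕ} {𝒜 : Finset (Finset α)} (h𝒜 : 𝒜 ⊆ Uq M (q + 2) q)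
    {T : Finset α} (hT : T ∈ hull M 𝒜) {z : α} (hz : z ∈ gr M) (hzcl : z ∉ clF M T) :
    insert z T ∈ shadow M (q + 2) q 𝒜 := by
  obtain ⟨hTg, hTq, B, hB, hBT, -⟩ := hull_facts h𝒜 hT
  have hzE : z ∈ M.E \ M.closure (T : Set α) := by
    refine ⟨by rw [← coe_gr]; exact_mod_cast hz, ?_⟩
    rw [← coe_clF]
    exact_mod_cast hzcl
  have hr : M.eRk ((insert z T : Finset α) : Set α) = ((q + 1 : ℕ) : ℕ∞) := by
    rw [Finset.coe_insert, Matroid.eRk_insert_eq_add_one hzE, hTq]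
    push_cast
    rfl
  rw [mem_shadow]
  refine ⟨?_, B, hB, hBT.trans (Finset.subset_insert _ _)⟩
  unfold Yq
  rw [Finset.mem_filter, Finset.mem_powerset, hr]
  refine ⟨Finset.insert_subset hz hTg, ?_, ?_⟩
  · exact_mod_cast (by omega : q < q + 1)
  · exact_mod_cast (by omega : q + 1 < q + 2)

/-- A hull set does not contain an element outside its closure. -/
theorem notMem_of_notMem_clF_hull {p q : ℕ} {𝒜 : Finset (Finset α)} (h𝒜 : 𝒜 ⊆ Uq M p q) {T : Finset α}
    (hT : T ∈ hull M 𝒜) {z : α} (hz : z ∉ clF M T) : z ∉ T := by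
  intro hzT
  apply hz
  obtain ⟨hTg, -, -⟩ := hull_facts h𝒜 hT
  rw [← Finset.mem_coe, coe_clF]
  exact M.subset_closure _ (by rw [← coe_gr]; exact_mod_cast hTg) (by exact_mod_cast hzT)

/-- **The direct-hull bound at `x`**: `#{T ∈ hull : x ∉ cl T} + (Σ_{T ∈ hull, x ∉ T} #((E ∖ cl T) ∖ {x})) / (q + 1)`. -/
noncomputable def directHull (M : Matroid α) [M.Finite] (q : ℕ) (𝒜 : Finset (Finset α)) (x : α) : ℚ :=
  (((hull M 𝒜).filter (fun T => x ∉ clF M T)).card : ℚ) +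
    ((∑ T ∈ (hull M 𝒜).filter (fun T => x ∉ T), ((gr M \ clF M T).erase x).card : ℕ) : ℚ) / (q + 1)

/-- **The direct-hull bound is a lower bound for the shadow** (for every ground element `x`). -/
theorem directHull_le_card_shadow {q : ℕ} {𝒜 : Finset (Finset α)} (h𝒜 : 𝒜 ⊆ Uq M (q + 2) q) {x : α}
    (hx : x ∈ gr M) : directHull M q 𝒜 x ≤ ((shadow M (q + 2) q 𝒜).card : ℚ) := by
  classical
  set H1 : Finset (Finset α) := (hull M 𝒜).filter (fun T => x ∉ clF M T) with hH1
  set H0 : Finset (Finset α) := (hull M 𝒜).filter (fun T => x ∉ T) with hH0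
  -- part 1: the sets T ∪ {x}, T ∈ H1
  set P1 : Finset (Finset α) := H1.image (fun T => insert x T) with hP1
  have hP1card : P1.card = H1.card := by
    apply Finset.card_image_of_injOn
    intro T hT T' hT' hTT'
    rw [Finset.mem_coe, hH1, Finset.mem_filter] at hT hT'
    have h1 : x ∉ T := notMem_of_notMem_clF_hull h𝒜 hT.1 hT.2
    have h2 : x ∉ T' := notMem_of_notMem_clF_hull h𝒜 hT'.1 hT'.2
    have hTT'' : insert x T = insert x T' := hTT'
    calc T = (insert x T).erase x := (Finset.erase_insert h1).symm
      _ = (insert x T').erase x := by rw [hTT'']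
      _ = T' := Finset.erase_insert h2
  have hP1sub : P1 ⊆ shadow M (q + 2) q 𝒜 := by
    intro S hS
    rw [hP1, Finset.mem_image] at hS
    obtain ⟨T, hT, rfl⟩ := hS
    rw [hH1, Finset.mem_filter] at hT
    exact insert_mem_shadow_of_mem_hull h𝒜 hT.1 hx hT.2
  have hP1x : ∀ S ∈ P1, x ∈ S := by
    intro S hS
    rw [hP1, Finset.mem_image] at hS
    obtain ⟨T, -, rfl⟩ := hS
    exact Finset.mem_insert_self _ _
  -- part 2: the pairs (T, z), T ∈ H0, z ∉ cl T, z ≠ x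
  set P : Finset (Σ _ : Finset α, α) := H0.sigma (fun T => (gr M \ clF M T).erase x) with hP
  let f : (Σ _ : Finset α, α) → Finset α := fun y => insert y.2 y.1
  set P2 : Finset (Finset α) := P.image f with hP2
  have hmemP : ∀ y ∈ P, y.1 ∈ hull M 𝒜 ∧ x ∉ y.1 ∧ y.2 ∈ gr M ∧ y.2 ∉ clF M y.1 ∧ y.2 ≠ x := by
    intro y hy
    rw [hP, Finset.mem_sigma, hH0, Finset.mem_filter, Finset.mem_erase, Finset.mem_sdiff] at hy
    exact ⟨hy.1.1, hy.1.2, hy.2.2.1, hy.2.2.2, hy.2.1⟩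
  have hPcard : P.card = ∑ T ∈ H0, ((gr M \ clF M T).erase x).card := by
    rw [hP, Finset.card_sigma]
  have hP2sub : P2 ⊆ shadow M (q + 2) q 𝒜 := by
    intro S hS
    rw [hP2, Finset.mem_image] at hS
    obtain ⟨y, hy, rfl⟩ := hS
    obtain ⟨hy1, -, hy3, hy4, -⟩ := hmemP y hy
    exact insert_mem_shadow_of_mem_hull h𝒜 hy1 hy3 hy4
  have hP2x : ∀ S ∈ P2, x ∉ S := by
    intro S hS
    rw [hP2, Finset.mem_image] at hS
    obtain ⟨y, hy, rfl⟩ := hS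
    obtain ⟨-, hy2, -, -, hy5⟩ := hmemP y hy
    rw [Finset.mem_insert]
    rintro (h | h)
    · exact hy5 h.symm
    · exact hy2 h
  -- each set of P2 has at most q + 1 preimages
  have hfib : P.card ≤ (q + 1) * P2.card := by
    rw [hP2]
    apply Finset.card_le_mul_card_image
    intro S hS
    rw [Finset.mem_image] at hS
    obtain ⟨y0, hy0, rfl⟩ := hS
    obtain ⟨hy01, -, hy03, hy04, -⟩ := hmemP y0 hy0
    obtain ⟨hTg, hTq, -⟩ := hull_facts h𝒜 hy01
    have hSg : f y0 ⊆ gr M := Finset.insert_subset hy03 hTg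
    have hSr : M.eRk ((f y0 : Finset α) : Set α) = ((q + 1 : ℕ) : ℕ∞) := by
      have hzE : y0.2 ∈ M.E \ M.closure (y0.1 : Set α) := by
        refine ⟨by rw [← coe_gr]; exact_mod_cast hy03, ?_⟩
        rw [← coe_clF]
        exact_mod_cast hy04
      show M.eRk ((insert y0.2 y0.1 : Finset α) : Set α) = _
      rw [Finset.coe_insert, Matroid.eRk_insert_eq_add_one hzE, hTq]
      push_cast
      rfl
    have hinj : ((P.filter (fun y => f y = f y0)).card) ≤ (coloops M (f y0)).card := by
      apply Finset.card_le_card_of_injOn (fun y => y.2)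
      · intro y hy
        rw [Finset.coe_filter] at hy
        obtain ⟨hyP, hyf⟩ := hy
        obtain ⟨hy1, -, -, hy4, -⟩ := hmemP y hyP
        have hzy : y.2 ∉ y.1 := notMem_of_notMem_clF_hull h𝒜 hy1 hy4
        rw [Finset.mem_coe, mem_coloops]
        refine ⟨?_, ?_⟩
        · rw [← hyf]; exact Finset.mem_insert_self _ _
        · have : (f y0).erase y.2 = y.1 := by
            rw [← hyf]
            exact Finset.erase_insert hzy
          rw [this]
          exact hy4
      · intro y hy y' hy' hyy'
        rw [Finset.coe_filter] at hy hy'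
        obtain ⟨hyP, hyf⟩ := hy
        obtain ⟨hy'P, hy'f⟩ := hy'
        obtain ⟨hy1, -, -, hy4, -⟩ := hmemP y hyP
        obtain ⟨hy'1, -, -, hy'4, -⟩ := hmemP y' hy'P
        have hzy : y.2 ∉ y.1 := notMem_of_notMem_clF_hull h𝒜 hy1 hy4
        have hzy' : y'.2 ∉ y'.1 := notMem_of_notMem_clF_hull h𝒜 hy'1 hy'4
        have hy' : y.1 = (f y0).erase y.2 := by rw [← hyf]; exact (Finset.erase_insert hzy).symm
        have hy'' : y'.1 = (f y0).erase y'.2 := by rw [← hy'f]; exact (Finset.erase_insert hzy').symm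
        have hyy'' : y.2 = y'.2 := hyy'
        have h1 : y.1 = y'.1 := by rw [hy', hy'', hyy'']
        exact Sigma.ext h1 (heq_of_eq hyy'')
    calc ((P.filter (fun y => f y = f y0)).card) ≤ (coloops M (f y0)).card := hinj
      _ ≤ q + 1 := card_coloops_le hSg hSr
  -- assemble
  have hdisj : Disjoint P1 P2 := by
    rw [Finset.disjoint_left]
    intro S hS1 hS2
    exact hP2x S hS2 (hP1x S hS1)
  have hunion : (P1 ∪ P2).card ≤ (shadow M (q + 2) q 𝒜).card :=
    Finset.card_le_card (Finset.union_subset hP1sub hP2sub)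
  rw [Finset.card_union_of_disjoint hdisj, hP1card] at hunion
  have hfib' : ((∑ T ∈ H0, ((gr M \ clF M T).erase x).card : ℕ) : ℚ) ≤ ((q : ℚ) + 1) * (P2.card : ℚ) := by
    rw [← hPcard]
    have h' : ((P.card : ℕ) : ℚ) ≤ (((q + 1) * P2.card : ℕ) : ℚ) := by exact_mod_cast hfib
    push_cast at h'
    exact h'
  have hS : (H1.card : ℚ) + (P2.card : ℚ) ≤ ((shadow M (q + 2) q 𝒜).card : ℚ) := by exact_mod_cast hunion
  have hq1 : (0 : ℚ) < (q : ℚ) + 1 := by positivity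
  unfold directHull
  rw [← hH1, ← hH0]
  have h2 : ((∑ T ∈ H0, ((gr M \ clF M T).erase x).card : ℕ) : ℚ) / ((q : ℚ) + 1) ≤ (P2.card : ℚ) := by
    rw [div_le_iff₀ hq1]
    linarith
  linarith

/-- **THE SELECTION CONJECTURE** (census: every loopless matroid on ≤ 8 elements, every sub-family of the bottom sets
whose closures cover the ground set with empty intersection — 129,078 tests, 0 failures): some ground element makes the
direct-hull bound reach `((q + 2)/(q + 1)) · #𝒜`.  With the e-lemma and the contraction regime this is the open piece of
the inductive step of the diagonal shadow form. -/
def DirectHullSelection : Prop :=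
  ∀ {α : Type} [DecidableEq α] (M : Matroid α) [M.Finite] (q : ℕ), M.eRank = ((q + 2 : ℕ) : ℕ∞) →
    ∀ 𝒜 ⊆ Uq M (q + 2) q, 𝒜.Nonempty →
      (∀ x ∈ gr M, ∃ B ∈ 𝒜, x ∈ clF M B) → (∀ x ∈ gr M, ∃ B ∈ 𝒜, x ∉ clF M B) →
        ∃ x ∈ gr M, ((q + 2 : ℚ) / (q + 1)) * (𝒜.card : ℚ) ≤ directHull M q 𝒜 x

/-- The selection conjecture gives the shadow condition for the mixed families. -/
theorem card_shadow_of_selection (hsel : DirectHullSelection) {α : Type} [DecidableEq α] (M : Matroid α) [M.Finite]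
    {q : ℕ} (hM : M.eRank = ((q + 2 : ℕ) : ℕ∞)) {𝒜 : Finset (Finset α)} (h𝒜 : 𝒜 ⊆ Uq M (q + 2) q)
    (hne : 𝒜.Nonempty) (hcov : ∀ x ∈ gr M, ∃ B ∈ 𝒜, x ∈ clF M B) (hint : ∀ x ∈ gr M, ∃ B ∈ 𝒜, x ∉ clF M B) :
    ((q + 2 : ℚ) / (q + 1)) * (𝒜.card : ℚ) ≤ ((shadow M (q + 2) q 𝒜).card : ℚ) := by
  obtain ⟨x, hx, hle⟩ := hsel M q hM 𝒜 h𝒜 hne hcov hint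
  exact le_trans hle (directHull_le_card_shadow h𝒜 hx)

end PercRepro.Shadow
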